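import Summits.BirchSwinnertonDyer.BirchSwinnertonDyer.Theorems.PrintCf2RamifiedOffTYZRankZeroDigitWang
import HarnessLib

/-!
# The rank-zero digit of a COMPOSITE coefficient `𝓛(l₁l₂)` (`l₁, l₂ ≡ 1 (mod 8)`): `(l₁/l₂) = 1 ⟹ 4 ∣ 𝓛(l₁l₂)`; `(l₁/l₂) = −1 ⟹ (¬4 ∣ 𝓛(l₁l₂) ⟺ δ odd)`
# (crux stmt-BirchSwinnertonDyer-20509 `RamifiedOffTYZOfFacts`, line `offtyz-v7`, LEAD cruxlead-20509 g25, cycle 26; `def`-free, no `sorry`)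

HONEST FRAMING (cell `bsd-print-cf2`, route `PrintCf2`; `--supports stmt-BirchSwinnertonDyer-20509`).  BSD is not proved by any of this; no
class is closed by this file; item 23431 (C⁺) and crux 20509 stay OPEN.

Sequel of `PrintCf2RamifiedOffTYZRankZeroDigit{,Wang}`.  On the block-free `k = 3` sector of the jump-one class (`n = l₁l₂q`, `l₁ ≡ l₂ ≡ 1`,
`q ≡ 7 (mod 8)`; g18's census, 53 rows) TYZ's recursion `P(n) = Z(n) − ε𝓛(l₁l₂)P(q) − ε𝓛(l₂)P(l₁q) − ε𝓛(l₁)P(l₂q)` carries, besides the prime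
coefficients `𝓛(lᵢ)` (digit: `…RankZeroDigit{,Wang}`), the COMPOSITE rank-zero coefficient `𝓛(l₁l₂)`.  Its digit, inside 𝔅_ram (conjuncts 2, 4):

* §1 Monsky for `d = l₁l₂` (FACT-FREE, `monsky_card_selmerGroup_two_odd_holds`): the `4 × 4` matrix is `diag(A, A)` with `A = a·J`
  (`J` the all-ones `2 × 2` matrix, `a = [(l₂/l₁) ≠ 1] = [(l₁/l₂) ≠ 1]` by reciprocity); so **`(l₂/l₁) = 1 ⟹ s(l₁l₂) = 4`, `#Sel₂(E_{l₁l₂}) = 2⁶`**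
  and **`(l₂/l₁) = −1 ⟹ s(l₁l₂) = 2`, `#Sel₂(E_{l₁l₂}) = 2⁴`** (kernel `{(x, x, y, y)}` of order `4`).
* §2 ★ `four_dvd_scriptL_of_legendre_eq_one` — granted conjuncts 2, 4: `(l₂/l₁) = 1`, `r_an(E_{l₁l₂}) = 0`, `𝓛(l₁l₂)² = L²` ⟹ **`4 ∣ L`**, and
  `¬ 8 ∣ L ⟺ #Sel₄(E_{l₁l₂}) = 2⁶` (`Ш[2] ≅ (ℤ/2)⁴` forces two digits); ★ `four_dvd_iff_selmerFour_ne_of_legendre_eq_neg_one` — `(l₂/l₁) = −1`: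
  `L ≠ 0`, `2 ∣ L`, **`4 ∣ L ⟺ #Sel₄(E_{l₁l₂}) ≠ 2⁴`**.
* §3 ★★ WITH WANG 2016 (Thm 3 for general `k` with `h₄ = 1` supplied by Lemma 4): `not_four_dvd_scriptL_iff_odd_deltaCount_of_facts` — for ANY
  square-free `d` with all prime factors `≡ 1 (mod 8)`, `#Sel₂(E_d) = 2⁴`, `r_an(E_d) = 0`: **`¬ 4 ∣ 𝓛(d) ⟺ δ_d odd`** (`δ_d` = the number of prime
  factors `p = u² + 8v²` with `v` odd); for `d = l₁l₂` with `(l₂/l₁) = −1`: `¬ 4 ∣ 𝓛(l₁l₂) ⟺` exactly one of `l₁, l₂` is `δ = 1`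
  (`deltaCount_mul_of_primes`).

References: [cite: TianYuanZhang2017, §3.1 (p0011 L67–L73), §1 (1.1)]; [cite: HeathBrown1994SelmerCongruentII, §1 and Appendix (Monsky), typescript p. 39];
[cite: Wang2016CongruentSha, Thm. 3 (arXiv:1511.03810 p0011 L107–L131), Lemma 4 (p0010 L20–L22)]; [cite: BurungaleFlach2024, Thm 1.1 / Cor. 3];
[cite: IrelandRosen1990, Ch. 5 §2 Thm 1 (quadratic reciprocity)]; tree: `HeathBrown1994.natCard_ker_mulVecLin_eq`, `…RankZeroDigit{,Wang}`.
LEAD memo: `Lines/offtyz_v7_RankZeroDigit.md`.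
-/

noncomputable section

open scoped Classical

open WeierstrassCurve Literature.NumberTheory.EllipticCurves Literature.NumberTheory.EllipticCurves.TianYuanZhang2017
  Literature.NumberTheory.EllipticCurves.HeathBrown1994 Literature.NumberTheory.EllipticCurves.Wang2016

set_option autoImplicit false

namespace Summit.BirchSwinnertonDyer.PrintCf2.RankZeroDigit

/-! ## §1 Monsky's matrix of two primes `≡ 1 (mod 8)` -/

section Monsky

open Matrix

variable {l₁ l₂ : ℕ}

/-- Reciprocity in Monsky's additive currency: for `l₁ ≡ 1 (mod 4)` and `l₂` odd, `[(l₁/l₂) ≠ 1] = [(l₂/l₁) ≠ 1]`.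
[cite: IrelandRosen1990, Ch. 5 §2 Thm 1] -/
theorem addLegendreSym_symm_of_mod_four (h1 : l₁ % 4 = 1) (h2 : Odd l₂) :
    addLegendreSym l₁ l₂ = addLegendreSym l₂ l₁ := by
  unfold addLegendreSym
  rw [jacobiSym.quadratic_reciprocity_one_mod_four h1 h2]

/-- The Legendre matrix of two primes `l₁ ≡ 1 (mod 4)`, `l₂` odd is the constant matrix `a·J`, `a = [(l₂/l₁) ≠ 1]`.
[cite: HeathBrown1994SelmerCongruentII, Appendix (Monsky), typescript p. 39 L13–L26] -/
theorem legendreMatrix_two_eq_of (h1 : l₁ % 4 = 1) (h2 : Odd l₂) :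
    legendreMatrix ![l₁, l₂] = Matrix.of fun _ _ => addLegendreSym l₂ l₁ := by
  have hsymm := addLegendreSym_symm_of_mod_four h1 h2
  ext i j
  fin_cases i <;> fin_cases j <;>
    simp [legendreMatrix, Finset.sum_erase_eq_sub, Fin.sum_univ_two, hsymm]

/-- For primes (indeed odd numbers) `≡ 1 (mod 8)` Monsky's diagonal matrices `D₂`, `D₋₂` vanish. [cite: HeathBrown1994SelmerCongruentII, Appendix (Monsky), typescript p. 39 L10–L13] -/
theorem legendreDiagonal_two_eq_zero (h1 : l₁ % 8 = 1) (h2 : l₂ % 8 = 1) (a : ℤ) (ha : a = 2 ∨ a = -2) :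
    legendreDiagonal ![l₁, l₂] a = 0 := by
  have key : ∀ {l : ℕ}, l % 8 = 1 → addLegendreSym a l = 0 := by
    intro l hl
    have hodd : Odd l := Nat.odd_iff.mpr (by omega)
    apply addLegendreSym_of_eq_one
    rcases ha with rfl | rfl
    · rw [jacobiSym.at_two hodd, ZMod.χ₈_nat_eq_if_mod_eight]
      simp [hl, show l % 2 ≠ 0 by omega]
    · rw [jacobiSym.at_neg_two hodd, ZMod.χ₈'_nat_eq_if_mod_eight]
      simp [hl, show l % 2 ≠ 0 by omega]
  ext i j
  fin_cases i <;> fin_cases j <;> simp [legendreDiagonal, Matrix.diagonal, key h1, key h2]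

/-- **Monsky's matrix of two primes `≡ 1 (mod 8)` is `diag(aJ, aJ)`**, `a = [(l₂/l₁) ≠ 1]`, `J` the all-ones `2 × 2` matrix.
[cite: HeathBrown1994SelmerCongruentII, Appendix (Monsky), typescript p. 39 L27–L33] -/
theorem monskyMatrixOdd_two_eq (h1 : l₁ % 8 = 1) (h2 : l₂ % 8 = 1) :
    monskyMatrixOdd ![l₁, l₂] =
      Matrix.fromBlocks (Matrix.of fun _ _ => addLegendreSym l₂ l₁) 0 0 (Matrix.of fun _ _ => addLegendreSym l₂ l₁) := by
  have hodd : Odd l₂ := Nat.odd_iff.mpr (by omega)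
  rw [monskyMatrixOdd, legendreMatrix_two_eq_of (by omega) hodd, legendreDiagonal_two_eq_zero h1 h2 2 (Or.inl rfl),
    legendreDiagonal_two_eq_zero h1 h2 (-2) (Or.inr rfl), add_zero]

/-- **`(l₂/l₁) = 1 ⟹ s(l₁l₂) = 4`**: the matrix vanishes. [cite: HeathBrown1994SelmerCongruentII, Appendix (Monsky), typescript p. 39 L27–L33] -/
theorem monskySelmerRankOdd_two_of_legendre_eq_one (h1 : l₁ % 8 = 1) (h2 : l₂ % 8 = 1) (hJ : jacobiSym l₂ l₁ = 1) :
    monskySelmerRankOdd ![l₁, l₂] = 4 := by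
  have ha : addLegendreSym l₂ l₁ = 0 := addLegendreSym_of_eq_one hJ
  have hM : monskyMatrixOdd ![l₁, l₂] = 0 := by
    rw [monskyMatrixOdd_two_eq h1 h2, ha]
    have h0 : (Matrix.of fun (_ : Fin 2) (_ : Fin 2) => (0 : ZMod 2)) = 0 := by
      ext i j; rfl
    rw [h0, Matrix.fromBlocks_zero]
  rw [monskySelmerRankOdd, hM, Matrix.rank_zero]

/-- The kernel of `diag(J, J)` over `ℤ/2`: `z` with `z₀ = z₁` and `z₂ = z₃`. [folklore] -/
theorem fromBlocks_ones_mulVec_eq_zero_iff (z : Fin 2 ⊕ Fin 2 → ZMod 2) :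
    (Matrix.fromBlocks (Matrix.of fun (_ : Fin 2) (_ : Fin 2) => (1 : ZMod 2)) 0 0 (Matrix.of fun (_ : Fin 2) (_ : Fin 2) => (1 : ZMod 2))) *ᵥ z = 0 ↔
      z (Sum.inl 0) = z (Sum.inl 1) ∧ z (Sum.inr 0) = z (Sum.inr 1) := by
  have hJ : ∀ v : Fin 2 → ZMod 2, (Matrix.of fun (_ : Fin 2) (_ : Fin 2) => (1 : ZMod 2)) *ᵥ v = fun _ => v 0 + v 1 := by
    intro v; funext i; simp [Matrix.mulVec, dotProduct, Fin.sum_univ_two]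
  have hchar : ∀ a b : ZMod 2, a + b = 0 ↔ a = b := by decide
  rw [Matrix.fromBlocks_mulVec, Matrix.zero_mulVec, Matrix.zero_mulVec, add_zero, zero_add, hJ, hJ]
  constructor
  · intro h
    have h0 := congr_fun h (Sum.inl 0)
    have h1 := congr_fun h (Sum.inr 0)
    simp only [Sum.elim_inl, Sum.elim_inr, Function.comp_apply, Pi.zero_apply] at h0 h1
    exact ⟨(hchar _ _).mp h0, (hchar _ _).mp h1⟩
  · rintro ⟨h0, h1⟩
    funext i
    rcases i with i | i
    · simp only [Sum.elim_inl, Function.comp_apply, Pi.zero_apply]; exact (hchar _ _).mpr h0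
    · simp only [Sum.elim_inr, Function.comp_apply, Pi.zero_apply]; exact (hchar _ _).mpr h1

/-- The kernel of `diag(J, J)` has `4` elements (`≃ (ℤ/2)²` via `z ↦ (z₀, z₂)`). [folklore] -/
theorem card_ker_fromBlocks_ones :
    Fintype.card {z : Fin 2 ⊕ Fin 2 → ZMod 2 //
      (Matrix.fromBlocks (Matrix.of fun (_ : Fin 2) (_ : Fin 2) => (1 : ZMod 2)) 0 0 (Matrix.of fun (_ : Fin 2) (_ : Fin 2) => (1 : ZMod 2))) *ᵥ z = 0} = 4 := by
  let e : {z : Fin 2 ⊕ Fin 2 → ZMod 2 //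
      (Matrix.fromBlocks (Matrix.of fun (_ : Fin 2) (_ : Fin 2) => (1 : ZMod 2)) 0 0 (Matrix.of fun (_ : Fin 2) (_ : Fin 2) => (1 : ZMod 2))) *ᵥ z = 0} ≃
      ZMod 2 × ZMod 2 :=
    { toFun := fun z => (z.1 (Sum.inl 0), z.1 (Sum.inr 0))
      invFun := fun ab => ⟨Sum.elim (fun _ => ab.1) (fun _ => ab.2),
        (fromBlocks_ones_mulVec_eq_zero_iff _).mpr ⟨rfl, rfl⟩⟩
      left_inv := by
        rintro ⟨z, hz⟩
        obtain ⟨h0, h1⟩ := (fromBlocks_ones_mulVec_eq_zero_iff z).mp hz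
        apply Subtype.ext
        funext i
        rcases i with i | i <;> fin_cases i
        · rfl
        · exact h0
        · rfl
        · exact h1
      right_inv := fun _ => rfl }
  rw [Fintype.card_congr e, Fintype.card_prod, ZMod.card]

/-- **`(l₂/l₁) = −1 ⟹ s(l₁l₂) = 2`**: `#ker M = 4 = 2^{4 − rank M}`. [cite: HeathBrown1994SelmerCongruentII, Appendix (Monsky), typescript p. 39 L1–L9, L27–L33] -/
theorem monskySelmerRankOdd_two_of_legendre_eq_neg_one (h1 : l₁ % 8 = 1) (h2 : l₂ % 8 = 1) (hJ : jacobiSym l₂ l₁ = -1) :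
    monskySelmerRankOdd ![l₁, l₂] = 2 := by
  have ha : addLegendreSym l₂ l₁ = 1 := addLegendreSym_of_eq_neg_one hJ
  have hM : monskyMatrixOdd ![l₁, l₂] =
      Matrix.fromBlocks (Matrix.of fun (_ : Fin 2) (_ : Fin 2) => (1 : ZMod 2)) 0 0 (Matrix.of fun (_ : Fin 2) (_ : Fin 2) => (1 : ZMod 2)) := by
    rw [monskyMatrixOdd_two_eq h1 h2, ha]
  have hcard := natCard_ker_mulVecLin_eq (monskyMatrixOdd ![l₁, l₂])
  have h4 : Nat.card (LinearMap.ker (monskyMatrixOdd ![l₁, l₂]).mulVecLin) = 4 := by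
    rw [Nat.card_congr (Equiv.subtypeEquivRight (q := fun v => monskyMatrixOdd ![l₁, l₂] *ᵥ v = 0)
      fun v => by rw [LinearMap.mem_ker, Matrix.mulVecLin_apply]), Nat.card_eq_fintype_card]
    simp only [hM]
    convert card_ker_fromBlocks_ones
  have hc : Fintype.card (Fin 2 ⊕ Fin 2) = 4 := by simp
  rw [h4, hc] at hcard
  unfold monskySelmerRankOdd
  -- `4 = 2^(4 − rank)` forces `4 − rank = 2`
  have key : 4 - (monskyMatrixOdd ![l₁, l₂]).rank = 2 := by
    apply Nat.pow_right_injective le_rfl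
    show (2 : ℕ) ^ (4 - (monskyMatrixOdd ![l₁, l₂]).rank) = 2 ^ 2
    rw [← hcard]
  omega

/-- Monsky's theorem for `d = l₁l₂` transported to `congruentNumberCurve (l₁ * l₂)`. [cite: HeathBrown1994SelmerCongruentII, §1 and Appendix (Monsky)] -/
theorem natCard_selmerGroup_two_two_primes (hl₁ : l₁.Prime) (hl₂ : l₂.Prime) (h1 : l₁ % 8 = 1) (h2 : l₂ % 8 = 1) (hne : l₁ ≠ l₂) :
    Nat.card ((congruentNumberCurve (l₁ * l₂)).selmerGroup 2) = 2 ^ (2 + monskySelmerRankOdd ![l₁, l₂]) := by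
  have hp : ∀ i, ((![l₁, l₂] : Fin 2 → ℕ) i).Prime := fun i => by fin_cases i <;> assumption
  have hodd : ∀ i, Odd ((![l₁, l₂] : Fin 2 → ℕ) i) := fun i => by
    fin_cases i
    · exact Nat.odd_iff.mpr (by simp; omega)
    · exact Nat.odd_iff.mpr (by simp; omega)
  have hinj : Function.Injective (![l₁, l₂] : Fin 2 → ℕ) := by
    intro i j hij
    fin_cases i <;> fin_cases j
    · rfl
    · simp at hij; exact absurd hij hne
    · simp at hij; exact absurd hij.symm hne
    · rfl
  have h := monsky_card_selmerGroup_two_odd_holds 2 ![l₁, l₂] hp hodd hinj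
  have hprod : (∏ i : Fin 2, (![l₁, l₂] : Fin 2 → ℕ) i) = l₁ * l₂ := by simp [Fin.prod_univ_two]
  have key : ∀ n : ℕ, (∏ i : Fin 2, (![l₁, l₂] : Fin 2 → ℕ) i) = n →
      Nat.card ((congruentNumberCurve n).selmerGroup 2) = 2 ^ (2 + monskySelmerRankOdd ![l₁, l₂]) := by
    intro n hn
    subst hn
    exact h
  exact key _ hprod

/-- **`(l₂/l₁) = 1 ⟹ #Sel₂(E_{l₁l₂}) = 2⁶`** (fact-free). [cite: HeathBrown1994SelmerCongruentII, §1 and Appendix (Monsky)] -/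
theorem natCard_selmerGroup_two_two_primes_of_legendre_eq_one (hl₁ : l₁.Prime) (hl₂ : l₂.Prime) (h1 : l₁ % 8 = 1)
    (h2 : l₂ % 8 = 1) (hne : l₁ ≠ l₂) (hJ : jacobiSym l₂ l₁ = 1) :
    Nat.card ((congruentNumberCurve (l₁ * l₂)).selmerGroup 2) = 2 ^ (2 + 4) := by
  rw [natCard_selmerGroup_two_two_primes hl₁ hl₂ h1 h2 hne, monskySelmerRankOdd_two_of_legendre_eq_one h1 h2 hJ]

/-- **`(l₂/l₁) = −1 ⟹ #Sel₂(E_{l₁l₂}) = 2⁴`** (fact-free). [cite: HeathBrown1994SelmerCongruentII, §1 and Appendix (Monsky)] -/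
theorem natCard_selmerGroup_two_two_primes_of_legendre_eq_neg_one (hl₁ : l₁.Prime) (hl₂ : l₂.Prime) (h1 : l₁ % 8 = 1)
    (h2 : l₂ % 8 = 1) (hne : l₁ ≠ l₂) (hJ : jacobiSym l₂ l₁ = -1) :
    Nat.card ((congruentNumberCurve (l₁ * l₂)).selmerGroup 2) = 2 ^ (2 + 2) := by
  rw [natCard_selmerGroup_two_two_primes hl₁ hl₂ h1 h2 hne, monskySelmerRankOdd_two_of_legendre_eq_neg_one h1 h2 hJ]

end Monsky

/-! ## §2 The digit of `𝓛(l₁l₂)` inside 𝔅_ram -/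

section Digit

variable {l₁ l₂ : ℕ}

/-- The product of two distinct primes is square-free. [folklore] -/
theorem squarefree_mul_of_primes (hl₁ : l₁.Prime) (hl₂ : l₂.Prime) (hne : l₁ ≠ l₂) : Squarefree (l₁ * l₂) := by
  rw [Nat.squarefree_mul_iff]
  exact ⟨(Nat.coprime_primes hl₁ hl₂).mpr hne, hl₁.squarefree, hl₂.squarefree⟩

/-- ★ **`(l₂/l₁) = 1 ⟹ 4 ∣ 𝓛(l₁l₂)`, and `¬ 8 ∣ 𝓛(l₁l₂) ⟺ #Sel₄(E_{l₁l₂}) = 2⁶`.**  Granted conjuncts 2, 4 of 𝔅_ram: distinct primes `l₁, l₂ ≡ 1 (mod 8)`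
with `(l₂/l₁) = 1`, `r_an(E_{l₁l₂}) = 0`, `𝓛(l₁l₂)² = L²` ⟹ `#Ш(E_{l₁l₂})[2] = 2⁴` divides `#Ш = L²`, so `4 ∣ L`; and `8 ∤ L` iff `Ш[4] = Ш[2]` iff the
`4`-Selmer count is minimal. [cite: TianYuanZhang2017, §1 (1.1)] [cite: BurungaleFlach2024, Thm 1.1 / Cor. 3] [cite: HeathBrown1994SelmerCongruentII, Appendix (Monsky)] -/
theorem four_dvd_scriptL_of_legendre_eq_one (hmod : WeierstrassCurve.hasEntireLFunction_rat)
    (hCM0 : bsdTriple_of_hasCM_of_L_one_ne_zero) (hl₁ : l₁.Prime) (hl₂ : l₂.Prime) (h1 : l₁ % 8 = 1) (h2 : l₂ % 8 = 1)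
    (hne : l₁ ≠ l₂) (hJ : jacobiSym l₂ l₁ = 1) (h0 : (congruentNumberCurve (l₁ * l₂)).analyticRank = 0) {L : ℤ}
    (hL : IsScriptL (l₁ * l₂) L) :
    (4 : ℤ) ∣ L ∧ (¬ (8 : ℤ) ∣ L ↔ Nat.card ((congruentNumberCurve (l₁ * l₂)).selmerGroup 4) = 2 ^ 6) := by
  haveI : Fact (Nat.Prime 2) := ⟨Nat.prime_two⟩
  have hsq := squarefree_mul_of_primes hl₁ hl₂ hne
  have hS₂ := natCard_selmerGroup_two_two_primes_of_legendre_eq_one hl₁ hl₂ h1 h2 hne hJ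
  have hL0 := scriptL_ne_zero_of_facts hmod hCM0 hsq h0 hL
  obtain ⟨-, hle⟩ := le_two_mul_padicValInt_of_facts hmod hCM0 hsq h0 hL hS₂
  have hiff := two_mul_padicValInt_eq_iff_selmerFour_of_facts hmod hCM0 hsq h0 hL hS₂
  constructor
  · rw [show (4 : ℤ) = ((2 : ℕ) : ℤ) ^ 2 by norm_num, padicValInt_dvd_iff (p := 2)]
    exact Or.inr (by omega)
  · rw [show (8 : ℤ) = ((2 : ℕ) : ℤ) ^ 3 by norm_num, padicValInt_dvd_iff (p := 2), show (2 : ℕ) ^ 6 = 2 ^ (2 + 4) by norm_num, hiff]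
    constructor
    · intro h
      have h3 : ¬ 3 ≤ padicValInt 2 L := fun h3 => h (Or.inr h3)
      omega
    · intro h
      rintro (h0 | h3)
      · exact hL0 h0
      · omega

/-- ★ **`(l₂/l₁) = −1 ⟹ 2 ∣ 𝓛(l₁l₂)` and `4 ∣ 𝓛(l₁l₂) ⟺ #Sel₄(E_{l₁l₂}) ≠ 2⁴`.**  Granted conjuncts 2, 4 of 𝔅_ram: distinct primes `l₁, l₂ ≡ 1 (mod 8)` with
`(l₂/l₁) = −1` (`s(l₁l₂) = 2`), `r_an(E_{l₁l₂}) = 0`, `𝓛(l₁l₂)² = L²`. [cite: TianYuanZhang2017, §1 (1.1)] [cite: BurungaleFlach2024, Thm 1.1 / Cor. 3]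
[cite: HeathBrown1994SelmerCongruentII, Appendix (Monsky)] -/
theorem four_dvd_iff_selmerFour_ne_of_legendre_eq_neg_one (hmod : WeierstrassCurve.hasEntireLFunction_rat)
    (hCM0 : bsdTriple_of_hasCM_of_L_one_ne_zero) (hl₁ : l₁.Prime) (hl₂ : l₂.Prime) (h1 : l₁ % 8 = 1) (h2 : l₂ % 8 = 1)
    (hne : l₁ ≠ l₂) (hJ : jacobiSym l₂ l₁ = -1) (h0 : (congruentNumberCurve (l₁ * l₂)).analyticRank = 0) {L : ℤ}
    (hL : IsScriptL (l₁ * l₂) L) :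
    L ≠ 0 ∧ (2 : ℤ) ∣ L ∧ ((4 : ℤ) ∣ L ↔ Nat.card ((congruentNumberCurve (l₁ * l₂)).selmerGroup 4) ≠ 2 ^ 4) :=
  four_dvd_iff_selmerFour_ne_of_facts hmod hCM0 (squarefree_mul_of_primes hl₁ hl₂ hne) h0 hL
    (by rw [natCard_selmerGroup_two_two_primes_of_legendre_eq_neg_one hl₁ hl₂ h1 h2 hne hJ])

end Digit

/-! ## §3 With Wang 2016: `¬ 4 ∣ 𝓛(d) ⟺ δ_d` odd on the `s = 2` locus of the all-`1 (mod 8)` family -/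

section Wang

/-- **Wang's Thm 3 with `h₄ = 1` supplied by Lemma 4, K-free.**  Granted Wang 2016 Thm 3 + Lemma 4: for square-free `d ≡ 1 (mod 8)` all of whose
prime factors are `≡ 1 (mod 8)` and with `#Sel₂(E_d) = 2⁴` (`s(d) = 2`): `δ_d` odd ⟺ `rank E_d(ℚ) = 0 ∧ Ш(E_d)[2^∞] ≃ (ℤ/2)²`.
[cite: Wang2016CongruentSha, Thm. 3 (arXiv:1511.03810 p0011 L107–L131) and Lemma 4 (p0010 L20–L22)] -/
theorem odd_deltaCount_iff_rank_zero_and_sha_of_wang (h3 : thm3_rank_zero_and_sha_two_by_two)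
    (hL4 : lem4_card_selmerGroup_two_eq_sixteen_iff_h4) {d : ℕ} (hsq : Squarefree d) (hd8 : d % 8 = 1)
    (h8 : ∀ p ∈ d.primeFactors, p % 8 = 1) (hS₂ : Nat.card ((congruentNumberCurve d).selmerGroup 2) = 2 ^ 4) :
    haveI := isElliptic_congruentNumberCurve hsq.ne_zero
    Odd (deltaCount d) ↔
      ((congruentNumberCurve d).mordellWeilRank = 0 ∧
        Nonempty (AddCommGroup.primaryComponent (congruentNumberCurve d).sha 2 ≃+ (ZMod 2 × ZMod 2))) := by
  haveI := isElliptic_congruentNumberCurve hsq.ne_zero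
  haveI : Fact (-((d : ℕ) : ℤ) < 0) := ⟨by have := Nat.pos_of_ne_zero hsq.ne_zero; omega⟩
  have hK := isQuadraticFieldOfSqrt_sqrtField (-((d : ℕ) : ℤ))
  have h4' : ∀ p ∈ d.primeFactors, p % 4 = 1 := fun p hp => by have := h8 p hp; omega
  have h4 : Tian2014.fourTwoCard (ClassGroup (NumberField.RingOfIntegers (sqrtField (-((d : ℕ) : ℤ))))) = 2 :=
    (hL4 d hsq hd8 h4' _ hK).mp (by rw [hS₂]; norm_num)
  exact (h3 d hsq h8 _ hK h4).2

/-- ★★ **Wang's Thm 3 on the `s = 2` locus, read on `𝓛`.**  Granted conjuncts 2, 4 of 𝔅_ram and Wang 2016 Thm 3 + Lemma 4: for every square-free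
`d ≡ 1 (mod 8)` all of whose prime factors are `≡ 1 (mod 8)`, with `#Sel₂(E_d) = 2⁴` (`s(d) = 2`, whence `h₄(d) = 1` by Lemma 4), `ord_{s=1} L(E_d, s) = 0` and
`𝓛(d)² = L²`:  **`¬ 4 ∣ L ⟺ δ_d` is odd** (`δ_d` = the number of prime factors `p = u² + 8v²` of `d` with `v` odd).
[cite: Wang2016CongruentSha, Thm. 3 and Lemma 4] [cite: TianYuanZhang2017, §1 (1.1)] [cite: BurungaleFlach2024, Thm 1.1 / Cor. 3] -/
theorem not_four_dvd_scriptL_iff_odd_deltaCount_of_facts (hmod : WeierstrassCurve.hasEntireLFunction_rat)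
    (hCM0 : bsdTriple_of_hasCM_of_L_one_ne_zero) (h3 : thm3_rank_zero_and_sha_two_by_two)
    (hL4 : lem4_card_selmerGroup_two_eq_sixteen_iff_h4) {d : ℕ} (hsq : Squarefree d) (hd8 : d % 8 = 1)
    (h8 : ∀ p ∈ d.primeFactors, p % 8 = 1) (hS₂ : Nat.card ((congruentNumberCurve d).selmerGroup 2) = 2 ^ 4)
    (h0 : (congruentNumberCurve d).analyticRank = 0) {L : ℤ} (hL : IsScriptL d L) :
    ¬ (4 : ℤ) ∣ L ↔ Odd (deltaCount d) := by
  haveI := isElliptic_congruentNumberCurve hsq.ne_zero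
  haveI : Fact (Nat.Prime 2) := ⟨Nat.prime_two⟩
  obtain ⟨hL0, -, hiff⟩ := four_dvd_iff_selmerFour_ne_of_facts hmod hCM0 hsq h0 hL hS₂
  have hrk := mordellWeilRank_eq_zero_of_facts hmod hCM0 hsq h0
  obtain ⟨hfin, hcard⟩ := cardSha_eq_sq_of_facts hmod hCM0 hsq h0 hL
  haveI := hfin
  have hprim := natCard_primaryComponent_two_of_natCard_eq_sq (G := (congruentNumberCurve d).sha) hcard
  have hS₂' : Nat.card ((congruentNumberCurve d).selmerGroup 2) = 2 ^ (2 + 2) := by rw [hS₂]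
  have hdigit := two_mul_padicValInt_eq_iff_selmerFour_of_facts hmod hCM0 hsq h0 hL hS₂'
  rw [odd_deltaCount_iff_rank_zero_and_sha_of_wang h3 hL4 hsq hd8 h8 hS₂]
  constructor
  · intro h4L
    have hS₄ : Nat.card ((congruentNumberCurve d).selmerGroup 4) = 2 ^ (2 + 2) := by
      by_contra hne
      exact h4L (hiff.mpr (by simpa using hne))
    refine ⟨hrk, ?_⟩
    have hpc := primaryComponent_sha_two_eq_of_natCard_selmerGroup hsq (u := 2)
      (by rw [hS₂', hrk]) (by rw [hS₄, hrk])
    refine nonempty_addEquiv_prod_zmod_of_natCard_eq_sq 2 (fun g => ?_) hpc.2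
    have hg : (g : (congruentNumberCurve d).sha) ∈ AddSubgroup.torsionBy (congruentNumberCurve d).sha (2 : ℤ) := hpc.1 ▸ g.2
    have hg' : (2 : ℤ) • (g : (congruentNumberCurve d).sha) = 0 := by simpa using hg
    exact Subtype.ext (by
      rw [AddSubgroupClass.coe_nsmul, ZeroMemClass.coe_zero, ← natCast_zsmul]
      exact_mod_cast hg')
  · rintro ⟨-, ⟨e⟩⟩ h4L
    have hc4 : Nat.card (AddCommGroup.primaryComponent (congruentNumberCurve d).sha 2) = 2 ^ 2 := by
      rw [Nat.card_congr e.toEquiv, Nat.card_prod, Nat.card_zmod]; norm_num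
    rw [hprim] at hc4
    have hv : 2 * padicValInt 2 L = 2 := Nat.pow_right_injective le_rfl hc4
    exact hiff.mp h4L (by rw [hdigit.mpr hv])

variable {l₁ l₂ : ℕ}

/-- `δ_{l₁l₂} = δ_{l₁} + δ_{l₂}` for distinct primes: the prime factors of `l₁l₂` are `{l₁, l₂}`.
[cite: Wang2016CongruentSha, Thm. 3 (i) (arXiv:1511.03810 p0011 L127)] -/
theorem deltaCount_mul_of_primes (hl₁ : l₁.Prime) (hl₂ : l₂.Prime) (hne : l₁ ≠ l₂) :
    deltaCount (l₁ * l₂) = (if IsDeltaOne l₁ then 1 else 0) + (if IsDeltaOne l₂ then 1 else 0) := by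
  rw [deltaCount, Nat.primeFactors_mul hl₁.ne_zero hl₂.ne_zero, Nat.Prime.primeFactors hl₁, Nat.Prime.primeFactors hl₂,
    Finset.filter_union, Finset.filter_singleton, Finset.filter_singleton,
    Finset.card_union_of_disjoint (by
      by_cases ha : IsDeltaOne l₁ <;> by_cases hb : IsDeltaOne l₂ <;> simp [ha, hb, hne])]
  by_cases ha : IsDeltaOne l₁ <;> by_cases hb : IsDeltaOne l₂ <;> simp [ha, hb]

/-- ★★ **The composite digit by `l = u² + 8v²`.**  Granted conjuncts 2, 4 of 𝔅_ram and Wang 2016 Thm 3 + Lemma 4: distinct primes `l₁, l₂ ≡ 1 (mod 8)`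
with `(l₂/l₁) = −1`, `r_an(E_{l₁l₂}) = 0`, `𝓛(l₁l₂)² = L²` ⟹ **`¬ 4 ∣ L ⟺` exactly one of `l₁`, `l₂` is `u² + 8v²` with `v` odd**.
[cite: Wang2016CongruentSha, Thm. 3 and Lemma 4] [cite: TianYuanZhang2017, §1 (1.1)] [cite: BurungaleFlach2024, Thm 1.1 / Cor. 3] -/
theorem not_four_dvd_scriptL_two_primes_iff_of_facts (hmod : WeierstrassCurve.hasEntireLFunction_rat)
    (hCM0 : bsdTriple_of_hasCM_of_L_one_ne_zero) (h3 : thm3_rank_zero_and_sha_two_by_two)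
    (hL4 : lem4_card_selmerGroup_two_eq_sixteen_iff_h4) (hl₁ : l₁.Prime) (hl₂ : l₂.Prime) (h1 : l₁ % 8 = 1) (h2 : l₂ % 8 = 1)
    (hne : l₁ ≠ l₂) (hJ : jacobiSym l₂ l₁ = -1) (h0 : (congruentNumberCurve (l₁ * l₂)).analyticRank = 0) {L : ℤ}
    (hL : IsScriptL (l₁ * l₂) L) :
    ¬ (4 : ℤ) ∣ L ↔ (IsDeltaOne l₁ ↔ ¬ IsDeltaOne l₂) := by
  have h8 : ∀ p ∈ (l₁ * l₂).primeFactors, p % 8 = 1 := by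
    intro p hp
    rw [Nat.primeFactors_mul hl₁.ne_zero hl₂.ne_zero, Finset.mem_union, Nat.Prime.primeFactors hl₁, Nat.Prime.primeFactors hl₂,
      Finset.mem_singleton, Finset.mem_singleton] at hp
    rcases hp with rfl | rfl <;> assumption
  have hd8 : (l₁ * l₂) % 8 = 1 := by rw [Nat.mul_mod, h1, h2]
  rw [not_four_dvd_scriptL_iff_odd_deltaCount_of_facts hmod hCM0 h3 hL4 (squarefree_mul_of_primes hl₁ hl₂ hne) hd8 h8
    (natCard_selmerGroup_two_two_primes_of_legendre_eq_neg_one hl₁ hl₂ h1 h2 hne hJ) h0 hL, deltaCount_mul_of_primes hl₁ hl₂ hne]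
  by_cases ha : IsDeltaOne l₁ <;> by_cases hb : IsDeltaOne l₂ <;> simp [ha, hb]

end Wang

end Summit.BirchSwinnertonDyer.PrintCf2.RankZeroDigit

end
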